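import Literature.NumberTheory.GaloisCohomology.Howard2004.TransportConnectingKernelProofs
import Literature.NumberTheory.EllipticCurves.LocalKernelOfReductionGaloisTransportProofs
import Literature.NumberTheory.EllipticCurves.ZpExtensionEisensteinTwistResidualTau
import HarnessLib

/-!
# The transport of H.5(b) carries the STRICT (ordinary) kernel at `v̄` onto the strict kernel at `v`
# (theorems only)

`Proofs` file (theorems only; no definition, no named fact, no instance, no `sorry`).  Companion of
`TransportConnectingKernelProofs` (the transport `θ_v ∘ transport_v : H¹(K_v̄, T̄) → H¹(K_v, T̄)` of a conjugation datum with a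
`G_ℚ`-structure `θ` carries `ker H¹(j_v̄)` onto `ker H¹(j_v)` for a GLOBAL equivariant `j`).  At the places `v ∣ p`
Howard's condition on `T̄ = E[p]` is the strict (ordinary) kernel `ker (H¹(K_v, T̄) → H¹(K_v, T̄ / Fil_v T̄))` of a LOCAL
stable subgroup `Fil_v`, and `Fil_v̄ ≠ Fil_v` inside `T̄`: «`τ(Fil_v̄ T) = Fil_v T`» [B. Howard, Compositio Math. 140 (2004),
§3.2, arXiv:1202.6340 p. 16 L5–6: H.5 «follow(s) from … the fact that `τ(Fil_w̄ T) = Fil_w T`»].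
* §1 **`DiscreteGaloisModule.quotientMap_oneCocycleClass_eq_zero_iff`** — a class dies in `H¹(F, W/W⁺)` iff its cocycle is
  a coboundary modulo `W⁺`: `∃ e, ∀ g, c(g) − (g e − e) ∈ W⁺`.
* §2 **`ResidualTau.map_thetaH1_comp_transportH1_strictSubgroup_eq`** — for `Γ_{K_v̄}`-stable `F₁ ≤ T̄` and `Γ_{K_v}`-stable
  `F₂ ≤ T̄` with `x ∈ F₁ ↔ θ(δ_v x) ∈ F₂`: `(θ_v ∘ transport_v)(H¹_str(K_v̄, F₁)) = H¹_str(K_v, F₂)`.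
* §3 (private `mem_iff_of_forall_mem_of_natCard_le` — the `↔` from one inclusion and a cardinality inequality); for the curve and
  the canonical datum `ofLifts`: **`WeierstrassCurve.mem_torsionFilAt_iff_torsionMap_delta_mem_ofLifts`**
  (`a ∈ Fil_{σv} E[n] ↔ τ(δ_v a) ∈ Fil_v E[n]`, from x10b-p1-w5's `torsionMap_delta_apply_mem_torsionFilAt` at `v` and `σ v`).
* §4 **`WeierstrassCurve.map_thetaH1_comp_transportH1_strictSubgroup_torsionFilAt_ofLifts`** — for `T̄ = E_K[p]`,
  `θ = τ_*` (`residualTauGeomTorsion`): `(θ_v ∘ transport_v)(H¹_str(K_{σv}, Fil_{σv} E[p])) = H¹_str(K_v, Fil_v E[p])` — the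
  H.5(b) clause at `v ∣ p` ONCE the propagated condition `F̄_𝔮(w)` is identified with the strict kernel at `w = v, σ v`
  (true for non-anomalous `w`; cell `pub/bsd-print-x9`, seat x9-p1-w3, memo `H5B-AT-S-PLAN-w3g5.md` §3).
No summit statement is proved; BSD is not proved by any of this.

References: [Howard2004HeegnerKolyvagin] §1.3 H.5(b), §3.1–3.2 (arXiv:1202.6340 p. 7 L44–50, L96–97; p. 15 L56–62; p. 16
L5–6); [SerreGaloisCohomology1997] I §2.4, §5.8; [GreenbergLNM1716] §2.
-/

set_option autoImplicit false

noncomputable section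

open Function NumberField IsDedekindDomain Field
open scoped NumberField ContRepresentation

/-! ## §1 Classes dying in `H¹(F, W / W⁺)` -/

namespace Literature.NumberTheory.GaloisRepresentations.DiscreteGaloisModule

/-- **A class dies in `H¹(F, W/W⁺)` iff its cocycle is a coboundary modulo `W⁺`.** [cite: SerreGaloisCohomology1997, I §5.8]
[cite: GreenbergLNM1716, §2 (the ordinary condition)] -/
theorem quotientMap_oneCocycleClass_eq_zero_iff {F : Type} [Field F] {W : Type} [AddCommGroup W] [TopologicalSpace W]
    [DiscreteTopology W] (ρ : DiscreteGaloisModule F W) (Wp : Submodule ℤ W)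
    (h : ∀ σ : absoluteGaloisGroup F, Wp ≤ Wp.comap (ρ σ)) (c : contOneCocycles ρ.toTopRep) :
    ρ.quotientMap Wp h 1 (oneCocycleClass _ c) = 0 ↔ ∃ e : W, ∀ g : absoluteGaloisGroup F, c.1 g - (ρ g e - e) ∈ Wp := by
  have hq : ρ.quotientMap Wp h 1 (oneCocycleClass _ c) =
      ContinuousCohomology.map (ContinuousMonoidHom.id (absoluteGaloisGroup F)) (X := ρ.toTopRep)
        (Y := DiscreteGaloisModule.toTopRep (ρ.quotient Wp h))
        (TopRep.ofHom ⟨⟨Wp.mkQ.toAddMonoidHom.toIntLinearMap, continuous_of_discreteTopology⟩,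
          fun g ↦ ContinuousLinearMap.ext fun x ↦ rfl⟩) 1 (oneCocycleClass _ c) := rfl
  rw [hq, map_oneCocycleClass]
  constructor
  · intro h0
    obtain ⟨m, hm⟩ := (oneCocycleClass_eq_zero_iff _ _).mp h0
    obtain ⟨e, rfl⟩ := Submodule.mkQ_surjective Wp m
    refine ⟨e, fun g ↦ ?_⟩
    have hg := hm g
    change Wp.mkQ (c.1 g) = Wp.mkQ (ρ g e) - Wp.mkQ e at hg
    rw [← map_sub, Submodule.mkQ_apply, Submodule.mkQ_apply, Submodule.Quotient.eq] at hg
    exact hg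
  · rintro ⟨e, he⟩
    refine (oneCocycleClass_eq_zero_iff _ _).mpr ⟨Wp.mkQ e, fun g ↦ ?_⟩
    change Wp.mkQ (c.1 g) = Wp.mkQ (ρ g e) - Wp.mkQ e
    rw [← map_sub, Submodule.mkQ_apply, Submodule.mkQ_apply, Submodule.Quotient.eq]
    exact he g

end Literature.NumberTheory.GaloisRepresentations.DiscreteGaloisModule

namespace Literature.NumberTheory.GaloisCohomology.Howard2004

open Literature.NumberTheory.GaloisRepresentations Literature.NumberTheory.GaloisRepresentations.DiscreteGaloisModule
open Literature.NumberTheory.EllipticCurves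

/-! ## §2 The transport carries strict kernels to strict kernels -/

namespace ResidualTau

variable {K : Type} [Field K] [NumberField K] (cd : ConjugationDatum K)
  {N : Type} [AddCommGroup N] [TopologicalSpace N] [DiscreteTopology N] {R : Type} [CommRing R] [Module R N]
  (ρN : DiscreteGaloisModule K N) (A : ResidualTau (R := R) cd ρN) (v : HeightOneSpectrum (𝓞 K))

/-- The cocycle of `θ_v (transport_v [ζ])`: `h ↦ θ (δ_v · ζ(φ_v h))`.
[cite: Howard2004HeegnerKolyvagin, §1.3 (arXiv p. 7, L44–50, L93–97)] -/
theorem thetaH1_transportH1_oneCocycleClass (ζ : contOneCocycles (ρN.toLocal (Sum.inr (cd.σ • v))).toTopRep) :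
    ∃ ζ' : contOneCocycles (ρN.toLocal (Sum.inr v)).toTopRep,
      A.thetaH1 (Sum.inr v) (cd.transportH1 ρN v (oneCocycleClass _ ζ)) = oneCocycleClass _ ζ' ∧
        ∀ h, ζ'.1 h = A.θ (ρN (cd.δ v) (ζ.1 (cd.φ v h))) := by
  have e2 : ∀ c, A.thetaH1 (Sum.inr v) (oneCocycleClass _ c) = oneCocycleClass _
      (contOneCocycles.pullback (ContinuousMonoidHom.id _)
        (X := ((cd.twist ρN).toLocal (Sum.inr v)).toTopRep) (Y := (ρN.toLocal (Sum.inr v)).toTopRep)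
        (TopRep.ofHom ⟨⟨A.θ.toAddMonoidHom.toIntLinearMap, continuous_of_discreteTopology⟩,
          fun g ↦ ContinuousLinearMap.ext fun x ↦ A.compat _ x⟩) c) := fun c ↦ map_oneCocycleClass _ _ _ c
  refine ⟨_, (congrArg (A.thetaH1 (Sum.inr v)) (ConjugationDatum.transportH1_oneCocycleClass cd ρN v ζ)).trans (e2 _),
    fun h ↦ rfl⟩

/-- `Γ_{K_v}` acts on `θ (δ_v e)` through `φ_v`: `h · θ(δ_v e) = θ(δ_v · (φ_v h · e))`.
[cite: Howard2004HeegnerKolyvagin, §1.3 (arXiv p. 7, L44–48 and L93–95)] -/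
theorem toLocal_apply_θ_delta (h : absoluteGaloisGroup (v.adicCompletion K)) (e : N) :
    (ρN.toLocal (Sum.inr v)) h (A.θ (ρN (cd.δ v) e)) =
      A.θ (ρN (cd.δ v) ((ρN.toLocal (Sum.inr (cd.σ • v))) (cd.φ v h) e)) := by
  have h1 : (ρN.toLocal (Sum.inr v)) h (A.θ (ρN (cd.δ v) e)) =
      A.θ (ρN (cd.conj (absGaloisRestrict K (v.adicCompletion K) h)) (ρN (cd.δ v) e)) := (A.compat _ _).symm
  rw [h1, cd.conj_absGaloisRestrict_eq v h, map_mul, map_mul, Module.End.mul_apply, Module.End.mul_apply,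
    ← Module.End.mul_apply (ρN (cd.δ v)⁻¹), ← map_mul, inv_mul_cancel, map_one, Module.End.one_apply]
  rfl

/-- **`(θ_v ∘ transport_v)(H¹_str(K_v̄, F₁)) = H¹_str(K_v, F₂)`** for a `Γ_{K_v̄}`-stable `F₁ ≤ T̄` and a `Γ_{K_v}`-stable
`F₂ ≤ T̄` with `x ∈ F₁ ↔ θ(δ_v x) ∈ F₂` (for `T̄ = E[p]` at `v ∣ p`: `τ(Fil_v̄) = Fil_v`): a cocycle is a coboundary modulo
`F₁` iff its transport is a coboundary modulo `F₂`. [cite: Howard2004HeegnerKolyvagin, §1.3 H.5(b) and §3.2 (arXiv p. 16, L5–6)]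
[cite: SerreGaloisCohomology1997, I §2.4 and §5.8] -/
theorem map_thetaH1_comp_transportH1_strictSubgroup_eq (F₁ : Submodule ℤ N)
    (hF₁ : ∀ g : absoluteGaloisGroup ((cd.σ • v).adicCompletion K), F₁ ≤ F₁.comap ((ρN.toLocal (Sum.inr (cd.σ • v))) g))
    (F₂ : Submodule ℤ N) (hF₂ : ∀ g : absoluteGaloisGroup (v.adicCompletion K), F₂ ≤ F₂.comap ((ρN.toLocal (Sum.inr v)) g))
    (hF : ∀ x, x ∈ F₁ ↔ A.θ (ρN (cd.δ v) x) ∈ F₂) :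
    ((ρN.toLocal (Sum.inr (cd.σ • v))).strictSubgroup F₁ hF₁).map ((A.thetaH1 (Sum.inr v)).comp (cd.transportH1 ρN v)) =
      (ρN.toLocal (Sum.inr v)).strictSubgroup F₂ hF₂ := by
  obtain ⟨ψ, hφψ, hψφ, -⟩ := cd.exists_continuous_inverse_phi v
  -- additivity of `x ↦ θ(δ_v x)`
  have hsub : ∀ x y z : N, A.θ (ρN (cd.δ v) (x - (y - z))) =
      A.θ (ρN (cd.δ v) x) - (A.θ (ρN (cd.δ v) y) - A.θ (ρN (cd.δ v) z)) := fun x y z ↦ by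
    rw [map_sub, map_sub, map_sub, map_sub]
  ext y
  constructor
  · rintro ⟨z, hz, rfl⟩
    obtain ⟨ζ, rfl⟩ := oneCocycleClass_surjective _ z
    obtain ⟨e, he⟩ := (quotientMap_oneCocycleClass_eq_zero_iff _ F₁ hF₁ ζ).mp hz
    obtain ⟨ζ', hζ', hζ'apply⟩ := thetaH1_transportH1_oneCocycleClass cd ρN A v ζ
    rw [AddMonoidHom.comp_apply, hζ']
    refine (quotientMap_oneCocycleClass_eq_zero_iff _ F₂ hF₂ ζ').mpr ⟨A.θ (ρN (cd.δ v) e), fun h ↦ ?_⟩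
    have key : ζ'.1 h - ((ρN.toLocal (Sum.inr v)) h (A.θ (ρN (cd.δ v) e)) - A.θ (ρN (cd.δ v) e)) =
        A.θ (ρN (cd.δ v) (ζ.1 (cd.φ v h) - ((ρN.toLocal (Sum.inr (cd.σ • v))) (cd.φ v h) e - e))) := by
      rw [hsub, ← toLocal_apply_θ_delta cd ρN A v h e, ← hζ'apply h]
    exact key ▸ (hF _).mp (he (cd.φ v h))
  · intro hy
    obtain ⟨x, rfl⟩ := (bijective_cohomologyMap_of_bijective ((cd.twist ρN).toLocal (Sum.inr v)) (ρN.toLocal (Sum.inr v))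
      A.θ.toAddMonoidHom (fun g x ↦ A.compat _ x) (Function.Involutive.bijective A.involutive)).2 y
    obtain ⟨z, rfl⟩ := cd.transportH1_surjective ρN v x
    refine ⟨z, ?_, rfl⟩
    obtain ⟨ζ, rfl⟩ := oneCocycleClass_surjective _ z
    obtain ⟨ζ', hζ', hζ'apply⟩ := thetaH1_transportH1_oneCocycleClass cd ρN A v ζ
    change A.thetaH1 (Sum.inr v) (cd.transportH1 ρN v (oneCocycleClass _ ζ)) ∈ _ at hy
    rw [hζ'] at hy
    obtain ⟨e', he'⟩ := (quotientMap_oneCocycleClass_eq_zero_iff _ F₂ hF₂ ζ').mp hy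
    refine (quotientMap_oneCocycleClass_eq_zero_iff _ F₁ hF₁ ζ).mpr ⟨ρN (cd.δ v)⁻¹ (A.θ e'), fun g ↦ (hF _).mpr ?_⟩
    have hee : A.θ (ρN (cd.δ v) (ρN (cd.δ v)⁻¹ (A.θ e'))) = e' := by
      rw [← Module.End.mul_apply, ← map_mul, mul_inv_cancel, map_one, Module.End.one_apply, A.involutive]
    have hg := he' (ψ g)
    have h3 : (ρN.toLocal (Sum.inr v)) (ψ g) e' =
        A.θ (ρN (cd.δ v) ((ρN.toLocal (Sum.inr (cd.σ • v))) g (ρN (cd.δ v)⁻¹ (A.θ e')))) := by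
      conv_lhs => rw [← hee]
      rw [toLocal_apply_θ_delta cd ρN A v (ψ g), hφψ]
    have key : ζ'.1 (ψ g) - ((ρN.toLocal (Sum.inr v)) (ψ g) e' - e') =
        A.θ (ρN (cd.δ v) (ζ.1 g - ((ρN.toLocal (Sum.inr (cd.σ • v))) g (ρN (cd.δ v)⁻¹ (A.θ e')) -
          ρN (cd.δ v)⁻¹ (A.θ e')))) := by
      rw [hsub, hee, hζ'apply (ψ g), hφψ, h3]
    exact key ▸ hg

end ResidualTau

/-! ## §3 `x ∈ F₁ ↔ f x ∈ F₂` from one inclusion and a cardinality bound -/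

/-- If an injective `f` maps the finite `F₁` into `F₂` and `|F₂| ≤ |F₁|` then `x ∈ F₁ ↔ f x ∈ F₂`. [folklore] -/
private theorem mem_iff_of_forall_mem_of_natCard_le {N : Type} [AddCommGroup N] (f : N → N) (hf : Function.Injective f)
    (F₁ F₂ : Submodule ℤ N) [Finite F₂] (h₁ : ∀ x ∈ F₁, f x ∈ F₂) (hcard : Nat.card F₂ ≤ Nat.card F₁) (x : N) :
    x ∈ F₁ ↔ f x ∈ F₂ := by
  refine ⟨h₁ x, fun hx ↦ ?_⟩
  let g : F₁ → F₂ := fun y ↦ ⟨f y, h₁ y y.2⟩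
  have hg : Function.Injective g := fun a b hab ↦ Subtype.ext (hf (congrArg Subtype.val hab))
  haveI : Finite F₁ := Finite.of_injective g hg
  have hbij : Function.Bijective g :=
    (Nat.bijective_iff_injective_and_card g).mpr ⟨hg, le_antisymm (Nat.card_le_card_of_injective g hg) hcard⟩
  obtain ⟨y, hy⟩ := hbij.2 ⟨f x, hx⟩
  have hyx : (y : N) = x := hf (congrArg Subtype.val hy)
  exact hyx ▸ y.2

end Literature.NumberTheory.GaloisCohomology.Howard2004

namespace WeierstrassCurve

open Literature.NumberTheory.EllipticCurves Literature.NumberTheory.GaloisRepresentations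
open Literature.NumberTheory.GaloisRepresentations.DiscreteGaloisModule
open Literature.NumberTheory.GaloisCohomology.Howard2004

variable {K : Type} [Field K] [NumberField K] (W : WeierstrassCurve ℚ) [W.IsElliptic] (σ : K ≃ₐ[ℚ] K) (hσ₁ : σ ≠ 1)
  (hσ : σ * σ = 1) (τ : AlgebraicClosure K ≃+* AlgebraicClosure K) (hτ : IsLiftOfAut σ τ) (hτ₂ : Function.Involutive τ)

/-- **`a ∈ Fil_{σv} E[n] ↔ τ(δ_v a) ∈ Fil_v E[n]`** for the canonical conjugation datum `ofLifts`: x10b-p1-w5's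
inclusion `torsionMap_delta_apply_mem_torsionFilAt` at `v` and at `σ v` (`σσv = v`), injectivity of `τ_* ∘ δ_v`, and
finiteness of `E[n]`. [cite: Howard2004HeegnerKolyvagin, §3.2 (arXiv p. 16, L5–6: τ(Fil_w̄ T) = Fil_w T)]
[cite: SilvermanAEC2009, VII.2 Props. 2.1–2.2] -/
theorem mem_torsionFilAt_iff_torsionMap_delta_mem_ofLifts (v : HeightOneSpectrum (𝓞 K)) {n : ℤ} (hn : n ≠ 0)
    (a : geomTorsion (W.baseChange K) n) :
    a ∈ (W.baseChange K).torsionFilAt (σ • v) n ↔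
      hτ.torsionMap W n ((W.baseChange K).torsionGaloisModule n ((ConjugationDatum.ofLifts σ hσ₁ hσ τ hτ hτ₂).δ v) a) ∈
        (W.baseChange K).torsionFilAt v n := by
  have inst : ∀ w : HeightOneSpectrum (𝓞 K), CharZero (w.adicCompletion K) := fun w ↦
    charZero_of_injective_algebraMap (algebraMap K (w.adicCompletion K)).injective
  haveI := inst v; haveI := inst (σ • v); haveI := inst (σ • (σ • v))
  haveI : Finite (geomTorsion (W.baseChange K) n) := (W.baseChange K).finite_geomTorsion hn
  have hvv : σ • (σ • v) = v := by rw [smul_smul, hσ, one_smul]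
  -- injectivity of `a ↦ τ(δ_w a)` at any place `w`
  have hinj : ∀ w : HeightOneSpectrum (𝓞 K), Function.Injective fun a : geomTorsion (W.baseChange K) n ↦
      hτ.torsionMap W n ((W.baseChange K).torsionGaloisModule n
        ((ConjugationDatum.ofLifts σ hσ₁ hσ τ hτ hτ₂).δ w) a) := by
    intro w a b hab
    have h1 : Function.Injective (hτ.torsionMap W n) :=
      hτ.torsionMap_injective W hτ₂ n
    have h2 := h1 hab
    simpa using h2
  refine mem_iff_of_forall_mem_of_natCard_le _ (hinj v) _ _
    (fun x hx ↦ W.torsionMap_delta_apply_mem_torsionFilAt σ hσ₁ hσ τ hτ hτ₂ v n hx) ?_ a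
  -- `|Fil_v| ≤ |Fil_{σv}|`: the same inclusion at the place `σ v`
  have h₂ : ∀ x ∈ (W.baseChange K).torsionFilAt v n,
      hτ.torsionMap W n ((W.baseChange K).torsionGaloisModule n
        ((ConjugationDatum.ofLifts σ hσ₁ hσ τ hτ hτ₂).δ (σ • v)) x) ∈ (W.baseChange K).torsionFilAt (σ • v) n := by
    intro x hx
    have hx' : x ∈ (W.baseChange K).torsionFilAt (σ • (σ • v)) n := by rwa [hvv]
    exact W.torsionMap_delta_apply_mem_torsionFilAt σ hσ₁ hσ τ hτ hτ₂ (σ • v) n hx'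
  let g : (W.baseChange K).torsionFilAt v n → (W.baseChange K).torsionFilAt (σ • v) n := fun x ↦ ⟨_, h₂ x x.2⟩
  have hg : Function.Injective g := fun a b hab ↦ Subtype.ext (hinj (σ • v) (congrArg Subtype.val hab))
  exact Nat.card_le_card_of_injective g hg

/-- **The transport of H.5(b) carries `H¹_str(K_{σv}, Fil_{σv} E[p])` onto `H¹_str(K_v, Fil_v E[p])`** (`T̄ = E_K[p]`,
`θ = τ_*` of `residualTauGeomTorsion`, canonical datum `ofLifts`): the H.5(b) clause at a place `v ∣ p` for the STRICT
kernels, «`τ(Fil_v̄ T) = Fil_v T`». [cite: Howard2004HeegnerKolyvagin, §1.3 H.5(b) (arXiv p. 7, L96–97) and §3.2 (p. 16, L5–6)]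
[cite: GreenbergLNM1716, §2] -/
theorem map_thetaH1_comp_transportH1_strictSubgroup_torsionFilAt_ofLifts {p : ℕ} [hp : Fact p.Prime] {m k : ℕ}
    (hm : 1 ≤ m) (hk : 1 ≤ k) (v : HeightOneSpectrum (𝓞 K)) :
    letI := IwasawaAlgebra.EisensteinCoeff.residueModule (p := p) (m := m) (k := k) hm hk
      ((W.baseChange K).prime_nsmul_geomTorsion_eq_zero (p := p))
    AddSubgroup.map
        (((W.residualTauGeomTorsion (p := p) (ConjugationDatum.ofLifts σ hσ₁ hσ τ hτ hτ₂) hm hk).thetaH1 (Sum.inr v)).comp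
          ((ConjugationDatum.ofLifts σ hσ₁ hσ τ hτ hτ₂).transportH1 ((W.baseChange K).torsionGaloisModule (p : ℤ)) v))
        ((((W.baseChange K).torsionGaloisModule (p : ℤ)).toLocal (Sum.inr (σ • v))).strictSubgroup
          ((W.baseChange K).torsionFilAt (σ • v) (p : ℤ))
          (fun g x hx ↦ (W.baseChange K).smul_mem_torsionFilAt (σ • v) (p : ℤ) g x hx)) =
      (((W.baseChange K).torsionGaloisModule (p : ℤ)).toLocal (Sum.inr v)).strictSubgroup
        ((W.baseChange K).torsionFilAt v (p : ℤ)) (fun g x hx ↦ (W.baseChange K).smul_mem_torsionFilAt v (p : ℤ) g x hx) := by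
  letI := IwasawaAlgebra.EisensteinCoeff.residueModule (p := p) (m := m) (k := k) hm hk
    ((W.baseChange K).prime_nsmul_geomTorsion_eq_zero (p := p))
  exact ResidualTau.map_thetaH1_comp_transportH1_strictSubgroup_eq (ConjugationDatum.ofLifts σ hσ₁ hσ τ hτ hτ₂)
    ((W.baseChange K).torsionGaloisModule (p : ℤ)) _ v _ _ _ _ fun x ↦
      W.mem_torsionFilAt_iff_torsionMap_delta_mem_ofLifts σ hσ₁ hσ τ hτ hτ₂ v
        (Int.natCast_ne_zero.mpr hp.out.ne_zero) x

end WeierstrassCurve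

end
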